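import Summits.CriticalPhenomena.SAWScalingLimit.Theorems.SAWTotalPositivityBoundaryTP2Defs
import Summits.CriticalPhenomena.SAWScalingLimit.Theorems.SAWTotalPositivityBoundaryTP2Kernel
import Summits.CriticalPhenomena.SAWScalingLimit.Theorems.SAWTotalPositivityBoundaryTP2Symmetry
import Summits.CriticalPhenomena.SAWScalingLimit.Theorems.EdgeOfPositivity.Negative.EdgeOfPositivityRectDomain
import HarnessLib

/-!
# Crux `BoundaryTP2` (stmt-CriticalPhenomena-7115), line `Sketch`: reflection symmetry of box kernels

Tool stub `stub_rect_reflect` of the line's skeleton: the self-avoiding path kernel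
`pathKernel (discreteDomainGraph (rectDomain a b) 1) x` of the box `{0..a} × {0..b}` is invariant under
the two axis reflections `(i,j) ↦ (a-i, j)` and `(i,j) ↦ (i, b-j)`.

The proof is in three generic steps, each recorded as a reusable lemma:
* `pathKernel_le_map` — along an injective graph homomorphism `f : H →g H'` self-avoiding paths are
  carried injectively to self-avoiding paths of the same length (Mathlib's `SimpleGraph.Path.map`), so
  `Z_H(a,b) ≤ Z_{H'}(f a, f b)` by comparison of `tsum`s along an injection;
* `pathKernel_map_iso` — for a graph isomorphism `φ : H ≃g H'` the two inequalities (for `φ` and for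
  `φ.symm`) give `Z_{H'}(φ a, φ b) = Z_H(a,b)` (no dependent-type transport of paths is needed);
* `exists_iso_rect_reflect_fst` / `exists_iso_rect_reflect_snd` — the two reflections are involutions
  of `Site 2` preserving lattice adjacency and membership in `rectSites a b`, hence (by `adj_rect_iff`)
  automorphisms of the box graph (which lives on all of `Site 2`; sites outside the box are isolated and
  are permuted among themselves).
-/

noncomputable section

namespace Summit.CriticalPhenomena.SAWScalingLimit.Theorems.BoundaryTP2

open Literature.Probability.LatticeModels Literature.Probability.RandomPlanarGeometry
open Summit.CriticalPhenomena.SAWScalingLimit.Theorems.EdgeOfPositivity.Negative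
open scoped ENNReal

/-! ## The path kernel along injective homomorphisms and isomorphisms -/

section Map

variable {V V' : Type*} {H : SimpleGraph V} {H' : SimpleGraph V'}

/-- The path kernel can only increase along an injective graph homomorphism `f : H →g H'`:
self-avoiding paths of `H` are carried injectively to self-avoiding paths of `H'` of the same length,
so `Z_H(a,b) ≤ Z_{H'}(f a, f b)`. [folklore] -/
theorem pathKernel_le_map (f : H →g H') (hf : Function.Injective f) (x : ℝ) (a b : V) :
    pathKernel H x a b ≤ pathKernel H' x (f a) (f b) := by
  calc pathKernel H x a b
      = ∑' γ : H.Path a b, ENNReal.ofReal (x ^ (SimpleGraph.Path.map f hf γ).1.length) := by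
        rw [pathKernel]
        refine tsum_congr fun γ => ?_
        rw [show (SimpleGraph.Path.map f hf γ).1.length = γ.1.length from
          SimpleGraph.Walk.length_map f γ.1]
    _ ≤ ∑' γ' : H'.Path (f a) (f b), ENNReal.ofReal (x ^ γ'.1.length) :=
        ENNReal.tsum_comp_le_tsum_of_injective (SimpleGraph.Path.map_injective hf a b)
          (fun γ' : H'.Path (f a) (f b) => ENNReal.ofReal (x ^ γ'.1.length))
    _ = pathKernel H' x (f a) (f b) := rfl

/-- **The path kernel is invariant under graph isomorphisms**: `Z_{H'}(φ a, φ b) = Z_H(a,b)` for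
`φ : H ≃g H'`. [folklore] -/
theorem pathKernel_map_iso (φ : H ≃g H') (x : ℝ) (a b : V) :
    pathKernel H' x (φ a) (φ b) = pathKernel H x a b := by
  refine le_antisymm ?_ (pathKernel_le_map φ.toHom φ.injective x a b)
  have h := pathKernel_le_map φ.symm.toHom φ.symm.injective x (φ a) (φ b)
  have ha : φ.symm.toHom (φ a) = a := φ.symm_apply_apply a
  have hb : φ.symm.toHom (φ b) = b := φ.symm_apply_apply b
  rw [ha, hb] at h
  exact h

end Map

/-! ## The two axis reflections of a box are graph automorphisms -/

/-- Adjacency of `ℤ²` in coordinates (local copy of the folklore characterisation): the two sites agree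
in one coordinate and differ by `1` in the other. [folklore] -/
private theorem zd2_adj_coord (x y : Site 2) :
    (zdGraph 2).Adj x y ↔
      ((y 0 = x 0 + 1 ∨ x 0 = y 0 + 1) ∧ y 1 = x 1) ∨
        ((y 1 = x 1 + 1 ∨ x 1 = y 1 + 1) ∧ y 0 = x 0) := by
  rw [zdGraph_adj_iff, Fin.exists_fin_two]
  simp only [funext_iff, Fin.forall_fin_two, Pi.add_apply, Pi.single_eq_same,
    Pi.single_eq_of_ne (one_ne_zero : (1 : Fin 2) ≠ 0),
    Pi.single_eq_of_ne (zero_ne_one : (0 : Fin 2) ≠ 1), add_zero]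
  omega

/-- Adjacency of the box graph `discreteDomainGraph (rectDomain a b) 1` in coordinates. [folklore] -/
private theorem adj_rect_coord {a b : ℕ} (x y : Site 2) :
    (discreteDomainGraph (rectDomain a b) 1).Adj x y ↔
      (((y 0 = x 0 + 1 ∨ x 0 = y 0 + 1) ∧ y 1 = x 1) ∨
          ((y 1 = x 1 + 1 ∨ x 1 = y 1 + 1) ∧ y 0 = x 0)) ∧
        ((0 ≤ x 0 ∧ x 0 ≤ a) ∧ (0 ≤ x 1 ∧ x 1 ≤ b)) ∧ ((0 ≤ y 0 ∧ y 0 ≤ a) ∧ (0 ≤ y 1 ∧ y 1 ≤ b)) := by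
  rw [adj_rect_iff, zd2_adj_coord, mem_rectSites_iff, mem_rectSites_iff]

/-- The reflection `(u₀, u₁) ↦ (a - u₀, u₁)` in the vertical axis of the box `{0..a} × {0..b}` is an
automorphism of the box graph `discreteDomainGraph (rectDomain a b) 1`. [folklore] -/
theorem exists_iso_rect_reflect_fst (a b : ℕ) :
    ∃ φ : discreteDomainGraph (rectDomain a b) 1 ≃g discreteDomainGraph (rectDomain a b) 1,
      ∀ v, φ v = st (a - v 0) (v 1) := by
  have hinv : Function.Involutive (fun v : Site 2 => st (a - v 0) (v 1)) := by
    intro v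
    simp only [st_zero, st_one, sub_sub_cancel]
    exact st_eta v
  refine ⟨{ toEquiv := hinv.toPerm _, map_rel_iff' := ?_ }, fun v => rfl⟩
  intro u v
  rw [Function.Involutive.coe_toPerm, adj_rect_coord, adj_rect_coord]
  simp only [st_zero, st_one]
  omega

/-- The reflection `(u₀, u₁) ↦ (u₀, b - u₁)` in the horizontal axis of the box `{0..a} × {0..b}` is an
automorphism of the box graph `discreteDomainGraph (rectDomain a b) 1`. [folklore] -/
theorem exists_iso_rect_reflect_snd (a b : ℕ) :
    ∃ φ : discreteDomainGraph (rectDomain a b) 1 ≃g discreteDomainGraph (rectDomain a b) 1,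
      ∀ v, φ v = st (v 0) (b - v 1) := by
  have hinv : Function.Involutive (fun v : Site 2 => st (v 0) (b - v 1)) := by
    intro v
    simp only [st_zero, st_one, sub_sub_cancel]
    exact st_eta v
  refine ⟨{ toEquiv := hinv.toPerm _, map_rel_iff' := ?_ }, fun v => rfl⟩
  intro u v
  rw [Function.Involutive.coe_toPerm, adj_rect_coord, adj_rect_coord]
  simp only [st_zero, st_one]
  omega

/-! ## The stub -/

/-- **Tool stub `stub_rect_reflect`.** The path kernel of the box `{0..a}×{0..b}` is invariant under the
reflections `(i,j) ↦ (a-i, j)` and `(i,j) ↦ (i, b-j)`: both are graph automorphisms of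
`discreteDomainGraph (rectDomain a b) 1` (a graph on all of `Site 2`, so no hypothesis on the sites is
needed), and the path kernel is invariant under graph isomorphisms (`pathKernel_map_iso`). [folklore] -/
theorem stub_rect_reflect (a b : ℕ) (x : ℝ) (i j i' j' : ℤ) :
    pathKernel (discreteDomainGraph (rectDomain a b) 1) x (st i j) (st i' j') =
      pathKernel (discreteDomainGraph (rectDomain a b) 1) x (st (a - i) j) (st (a - i') j') ∧
    pathKernel (discreteDomainGraph (rectDomain a b) 1) x (st i j) (st i' j') =
      pathKernel (discreteDomainGraph (rectDomain a b) 1) x (st i (b - j)) (st i' (b - j')) := by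
  obtain ⟨φ, hφ⟩ := exists_iso_rect_reflect_fst a b
  obtain ⟨ψ, hψ⟩ := exists_iso_rect_reflect_snd a b
  refine ⟨?_, ?_⟩
  · rw [← pathKernel_map_iso φ x (st i j) (st i' j'), hφ, hφ, st_zero, st_one, st_zero, st_one]
  · rw [← pathKernel_map_iso ψ x (st i j) (st i' j'), hψ, hψ, st_zero, st_one, st_zero, st_one]

end Summit.CriticalPhenomena.SAWScalingLimit.Theorems.BoundaryTP2
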